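import Literature.Barriers.RiemannHypothesis.DeBrangesPositivity
import Literature.Barriers.RiemannHypothesis.DeBrangesPositivityXiZeta
import Literature.Barriers.RiemannHypothesis.DeBrangesPositivityProofs
import Literature.NumberTheory.LFunctions.ZetaKernelEvaluation
import Literature.NumberTheory.LFunctions.MertensZeroCertificate
import Mathlib.Analysis.Real.Pi.Bounds
import HarnessLib

/-!
# Conrey–Li's failure of de Branges' `𝓗(E)`-positivity at the 34th zero: proof of `ConreyLi2000_HE`

Barrier catalogue `Literature/Barriers/RiemannHypothesis/`, sibling of `DeBrangesPositivity.lean`,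
`DeBrangesPositivityProofs.lean` (Sarnak's proof of `ConreyLi2000_FW`), `DeBrangesPositivityCert.lean`
(the printed (3.4)) and `DeBrangesPositivityXiZeta.lean` (reflection bookkeeping, reused here).
We **discharge** the named fact `Literature.Barriers.RiemannHypothesis.ConreyLi2000_HE`
(Conrey–Li 2000, §3.1 eq. (3.2)) and hence, with `ConreyLi2000_FW_holds`, the catalogued barrier
`Literature.Barriers.RiemannHypothesis.DeBrangesPositivity` (`DeBrangesPositivity_holds`): there is a
zero `ρ = ½ + iγ` of `ξ` with `111 < γ < 111.5` (the 34th zero of `ζ`, `γ₃₄ = 111.0295355431696745…`) at which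
`Re{conj ξ′(ρ) · ξ(1+ρ)} < 0` — the printed value, for Conrey–Li's `ξ_CL = 2ξ`, is
`−Re{ξ′_CL(ρ)ξ_CL(1+ρ)} = −5.389100507182945…·10⁻⁶⁹`, a MATHEMATICA evaluation. Here the sign is
*proved*, by a kernel-checked interval computation (`decide +kernel`, no compiler axiom).

## Method

**1. No `Γ`-numerics are needed** (`re_conj_deriv_riemannXi_mul_eq`). Write `ξ = A · ζ` with
`A(s) = ½ s(s−1) Γ_ℝ(s)`, `Γ_ℝ(s) = π^{-s/2} Γ(s/2)` (`xiFactor`; valid on `Re s > 0`, `s ≠ 1`).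
At a zero `ρ = ½ + iγ` of `ζ`, `ξ′(ρ) = A(ρ) ζ′(ρ)`, so
`conj ξ′(ρ) · ξ(1+ρ) = [conj A(ρ) · A(1+ρ)] · conj ζ′(ρ) · ζ(1+ρ)`, and since `conj ρ = 1 − ρ`,
`conj A(ρ) · A(1+ρ) = ¼ conj(ρ(ρ−1)) ρ(1+ρ) · Γ_ℝ(1−ρ) Γ_ℝ(1+ρ) = ¼ (γ²+¼)((γ²−¾) − 2γi) / cos(πρ/2)`
by the reflection formula `Γ_ℝ(1−s)Γ_ℝ(1+s) = 1/cos(πs/2)` (Mathlib's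
`Complex.Gammaℝ_one_sub_mul_Gammaℝ_one_add`). As `cos(πρ/2) = (√2/2)(cosh y − i sinh y)`,
`y = πγ/2`, one gets, with an explicit `c > 0`,

  `Re{conj ξ′(ρ) ξ(1+ρ)} = c · Re{ conj ζ′(ρ) · ζ(3/2+iγ) · ((γ²−¾) − 2γi) · (1 + i tanh y) }`,

and `tanh y ∈ [15/16, 1]` for `γ ≥ 3`. (Numerically `P = conj ζ′(ρ) ζ(1+ρ)((γ²−¾) − 2γi)
≈ 8839.6 + 10550.2 i`, `Re P − Im P ≈ −1710.6`: the failure is by `8.8 %` of `|P|√2` — the 34th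
and 35th zero, `111.03` and `111.87`, are unusually close.)

**2. The certificate** (`ConreyLi2000Cert`, scale `2^80`, Euler–Maclaurin with `N = 64`, `ν = 14`
through the kernel-evaluable evaluator `Literature.NumberTheory.LFunctions.ZetaNumerics.zetaBoxK` of
`ZetaKernelEvaluation.lean`): with `t₁ = T1/2⁴⁸ = γ₃₄ − 2⁻³³ + O(2⁻⁴⁸)`, `t₂ = t₁ + 2⁻³²`,
* `hi Re(ζ(½+it₁) · conj ζ(½+it₂)) < 0` (value `≈ −3.4·10⁻²⁰ ± 10⁻²³`), so `ζ(½+iγ) = 0` for some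
  `γ ∈ [t₁, t₂]` by the twisted sign test `Literature.NumberTheory.LFunctions.exists_zero_Icc_of_re_mul_conj_neg'`
  (`MertensZeroCertificate.lean`; `Z` real and `|θ′| ≤ 10`);
* `ζ′(½+iγ)` lies in the slope box `(ζ₂ − ζ₁)/((t₂−t₁)i)` widened by `(t₂−t₁)·4(t₂+4)³ ≤ 1.5·10⁻³`
  (`Literature.NumberTheory.LFunctions.norm_deriv_riemannZeta_sub_slope_le`), `ζ(3/2+iγ)` in one box
  evaluation over `{3/2} × [t₁, t₂]`, and the product box `W ∋ P (1 + τ i)`, `τ ∈ [15/16, 1]`, has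
  `hi Re W < 0` (`Re W ∈ [−1749, −1014]`).
`ConreyLi2000Cert.check_holds : check = true` is evaluated by the kernel in about `30 s`;
`ConreyLi2000Cert.sound` is its soundness, and `ConreyLi2000_HE_holds` assembles.

The numerical planning (`γ₃₄`, the bracket, expected margins) was done outside Lean in
multiprecision arithmetic and reproduces Conrey–Li's printed `−5.389100507182945·10⁻⁶⁹` through the
reduction of step 1; only the kernel's verdict is used.

## References

* [ConreyLi2000] J. B. Conrey, X.-J. Li, *A note on some positivity conditions related to zeta and
  L-functions*, IMRN 2000, no. 18, 929–940; arXiv:math/9812166, §3.1 eq. (3.2) and Appendix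
  (`ro1 = 1/2 + I*111.029535543169674524656`).
* [Edwards1974] H. M. Edwards, *Riemann's Zeta Function* (1974), §6.4 (Euler–Maclaurin).
* [Brent1979] R. P. Brent, *On the zeros of the Riemann zeta function in the critical strip*,
  Math. Comp. 33 (1979), §3 (zeros on the line from sign changes).
-/

open Complex Literature.NumberTheory.LFunctions
open Literature.Analysis.ValidatedNumerics.NumericsMP Literature.NumberTheory.LFunctions.ZetaNumerics
open scoped Real ComplexConjugate

namespace Literature.Barriers.RiemannHypothesis

/-! ## 1. Reduction to `ζ`-data (no `Γ`-numerics) -/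

/-- The factor `A(s) = s(s-1)/2 · Γ_ℝ(s)` (`Γ_ℝ(s) = π^{-s/2} Γ(s/2)`), with `ξ = A · ζ` on `Re s > 0`,
`s ≠ 1`. [folklore] -/
noncomputable def xiFactor (s : ℂ) : ℂ := s * (s - 1) / 2 * Gammaℝ s

/-- `ξ(s) = A(s) ζ(s)` for `Re s > 0`, `s ≠ 1` (`riemannXi_eq_Gammaℝ_mul_zeta` of
`DeBrangesPositivityXiZeta.lean`, regrouped). [folklore] -/
theorem riemannXi_eq_xiFactor_mul {s : ℂ} (hs : 0 < s.re) (hs1 : s ≠ 1) :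
    riemannXi s = xiFactor s * riemannZeta s := by
  rw [riemannXi_eq_Gammaℝ_mul_zeta hs hs1, xiFactor, mul_assoc]

/-- `A` is holomorphic on `Re s > 0`. [folklore] -/
theorem differentiableAt_xiFactor {s : ℂ} (hs : 0 < s.re) : DifferentiableAt ℂ xiFactor s := by
  have hG : Gammaℝ s ≠ 0 := Gammaℝ_ne_zero_of_re_pos hs
  have h1 : DifferentiableAt ℂ (fun z ↦ ((Gammaℝ z)⁻¹)⁻¹) s :=
    (differentiable_Gammaℝ_inv.differentiableAt).inv (inv_ne_zero hG)
  have h2 : (fun z ↦ ((Gammaℝ z)⁻¹)⁻¹) = Gammaℝ := funext fun z ↦ inv_inv _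
  rw [h2] at h1
  have h3 : DifferentiableAt ℂ (fun z : ℂ ↦ z * (z - 1) / 2) s := by fun_prop
  exact h3.mul h1

/-- `A(s) ≠ 0` for `Re s > 0`, `s ≠ 1`. [folklore] -/
theorem xiFactor_ne_zero {s : ℂ} (hs : 0 < s.re) (hs1 : s ≠ 1) : xiFactor s ≠ 0 := by
  unfold xiFactor
  have h0 : s ≠ 0 := fun h ↦ by simp [h] at hs
  have h1 : s - 1 ≠ 0 := sub_ne_zero.2 hs1
  exact mul_ne_zero (div_ne_zero (mul_ne_zero h0 h1) two_ne_zero) (Gammaℝ_ne_zero_of_re_pos hs)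

/-- At a zero `ρ` of `ζ` with `Re ρ > 0`: `ξ'(ρ) = A(ρ) ζ'(ρ)`. [folklore] -/
theorem deriv_riemannXi_eq_of_zero {ρ : ℂ} (hρ : 0 < ρ.re) (hρ1 : ρ ≠ 1)
    (hz : riemannZeta ρ = 0) : deriv riemannXi ρ = xiFactor ρ * deriv riemannZeta ρ := by
  have hopen : IsOpen ({s : ℂ | 0 < s.re} ∩ {s : ℂ | s ≠ 1}) :=
    (isOpen_lt continuous_const Complex.continuous_re).inter isOpen_ne
  have hev : riemannXi =ᶠ[nhds ρ] fun s ↦ xiFactor s * riemannZeta s := by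
    filter_upwards [hopen.mem_nhds ⟨hρ, hρ1⟩] with s hs
    exact riemannXi_eq_xiFactor_mul hs.1 hs.2
  rw [hev.deriv_eq, deriv_fun_mul (differentiableAt_xiFactor hρ) (differentiableAt_riemannZeta hρ1),
    hz, mul_zero, zero_add]

/-- `conj (½ + iγ) = 1 - (½ + iγ)`. [folklore] -/
theorem conj_half_add (γ : ℝ) : conj (1 / 2 + γ * I : ℂ) = 1 - (1 / 2 + γ * I) := by
  apply Complex.ext
  · simp; norm_num
  · simp

/-- The `Γ`-factors at a critical-line point: for `ρ = ½ + iγ`,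
`conj A(ρ) · A(1+ρ) = ((γ²+¼)/4) · ((γ² − ¾) − 2γ i) · (cos (πρ/2))⁻¹`
(conjugation symmetry of `Γ_ℝ` and the reflection formula
`Γ_ℝ(1-s) Γ_ℝ(1+s) = 1/cos(πs/2)`). [folklore] -/
theorem conj_xiFactor_mul_xiFactor (γ : ℝ) :
    conj (xiFactor (1 / 2 + γ * I)) * xiFactor (1 + (1 / 2 + γ * I)) =
      (((γ ^ 2 + 1 / 4) / 4 : ℝ) : ℂ) * (((γ ^ 2 - 3 / 4 : ℝ) : ℂ) - 2 * γ * I) *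
        (Complex.cos (π * (1 / 2 + γ * I) / 2))⁻¹ := by
  set ρ : ℂ := 1 / 2 + γ * I with hρ
  have hconj : conj ρ = 1 - ρ := conj_half_add γ
  have key := Gammaℝ_one_sub_mul_Gammaℝ_one_add ρ
  have e1 : conj (xiFactor ρ) = ρ * (ρ - 1) / 2 * Gammaℝ (1 - ρ) := by
    unfold xiFactor
    rw [map_mul, ← Gammaℝ_conj, hconj, map_div₀, map_mul, map_sub, map_one, hconj]
    congr 1
    rw [map_ofNat]
    ring
  rw [e1]
  unfold xiFactor
  calc ρ * (ρ - 1) / 2 * Gammaℝ (1 - ρ) * ((1 + ρ) * (1 + ρ - 1) / 2 * (1 + ρ).Gammaℝ)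
      = ρ * (ρ - 1) / 2 * ((1 + ρ) * (1 + ρ - 1) / 2) * (Gammaℝ (1 - ρ) * Gammaℝ (1 + ρ)) := by ring
    _ = ρ * (ρ - 1) / 2 * ((1 + ρ) * (1 + ρ - 1) / 2) * (Complex.cos (π * ρ / 2))⁻¹ := by rw [key]
    _ = _ := by
      congr 1
      rw [hρ]
      apply Complex.ext
      · simp [sq]; ring
      · simp [sq]; ring

/-- `cos (π(½ + iγ)/2) = (√2/2)(cosh(πγ/2) − i sinh(πγ/2))`. [folklore] -/
theorem cos_pi_mul_half_add (γ : ℝ) :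
    Complex.cos (π * (1 / 2 + γ * I) / 2) =
      ((Real.sqrt 2 / 2 : ℝ) : ℂ) * ((Real.cosh (π * γ / 2) : ℂ) - (Real.sinh (π * γ / 2) : ℂ) * I) := by
  have e : (π : ℂ) * (1 / 2 + γ * I) / 2 = ((π / 4 : ℝ) : ℂ) + ((π * γ / 2 : ℝ) : ℂ) * I := by
    push_cast; ring
  rw [e, Complex.cos_add, Complex.cos_mul_I, Complex.sin_mul_I, ← Complex.ofReal_cos,
    ← Complex.ofReal_sin, Real.cos_pi_div_four, Real.sin_pi_div_four, ← Complex.ofReal_cosh,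
    ← Complex.ofReal_sinh]
  ring

/-- `15/16 ≤ tanh (πγ/2) ≤ 1` for `γ ≥ 3` (from `one_sub_tanh_le` of
`DeBrangesPositivityXiZeta.lean`: `1 − tanh x ≤ 2/(1+x)²`, and `(1 + πγ/2)² ≥ 32`). [folklore] -/
theorem tanh_mem_Icc {γ : ℝ} (hγ : 3 ≤ γ) : Real.tanh (π * γ / 2) ∈ Set.Icc (15 / 16 : ℝ) 1 := by
  refine ⟨?_, tanh_le_one _⟩
  have hπ := Real.pi_gt_d2
  have hx : 4.71 ≤ π * γ / 2 := by nlinarith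
  have h := one_sub_tanh_le (x := π * γ / 2) (by linarith)
  have h32 : (32 : ℝ) ≤ (1 + π * γ / 2) ^ 2 := by nlinarith
  have : 2 / (1 + π * γ / 2) ^ 2 ≤ 2 / 32 := by
    apply div_le_div_of_nonneg_left (by norm_num) (by norm_num) h32
  linarith

/-- `1/cos(π(½ + iγ)/2) = c₁ · (1 + i tanh(πγ/2))` with `c₁ = (√2/2) cosh(πγ/2)/|cos(π(½+iγ)/2)|² > 0`.
[folklore] -/
theorem inv_cos_pi_mul_half_add (γ : ℝ) :
    ∃ c₁ : ℝ, 0 < c₁ ∧ (Complex.cos (π * (1 / 2 + γ * I) / 2))⁻¹ =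
      (c₁ : ℂ) * (1 + (Real.tanh (π * γ / 2) : ℂ) * I) := by
  have hC := cos_pi_mul_half_add γ
  set y : ℝ := π * γ / 2 with hy
  set C : ℂ := Complex.cos (π * (1 / 2 + γ * I) / 2) with hCdef
  have hch : 0 < Real.cosh y := Real.cosh_pos y
  have hs2 : 0 < Real.sqrt 2 / 2 := by positivity
  have hCre : C.re = Real.sqrt 2 / 2 * Real.cosh y := by
    rw [hC]
    simp only [Complex.mul_re, Complex.sub_re, Complex.ofReal_re, Complex.ofReal_im,
      Complex.mul_im, Complex.I_re, Complex.I_im, Complex.sub_im]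
    ring
  have hCne : C ≠ 0 := fun h ↦ by
    rw [h, Complex.zero_re] at hCre
    have : 0 < Real.sqrt 2 / 2 * Real.cosh y := mul_pos hs2 hch
    linarith
  set n : ℝ := Complex.normSq C with hndef
  have hn : 0 < n := Complex.normSq_pos.2 hCne
  refine ⟨Real.sqrt 2 / 2 * Real.cosh y / n, by positivity, ?_⟩
  rw [Complex.inv_def, ← hndef, hC, map_mul, Complex.conj_ofReal, map_sub, map_mul,
    Complex.conj_ofReal, Complex.conj_ofReal, Complex.conj_I, Real.tanh_eq_sinh_div_cosh]
  have hch' : Real.cosh y ≠ 0 := hch.ne'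
  apply Complex.ext
  · simp only [Complex.mul_re, Complex.mul_im, Complex.sub_re, Complex.sub_im, Complex.add_re,
      Complex.add_im, Complex.ofReal_re, Complex.ofReal_im, Complex.I_re, Complex.I_im,
      Complex.one_re, Complex.one_im, Complex.neg_re, Complex.neg_im]
    field_simp
    ring
  · simp only [Complex.mul_re, Complex.mul_im, Complex.sub_re, Complex.sub_im, Complex.add_re,
      Complex.add_im, Complex.ofReal_re, Complex.ofReal_im, Complex.I_re, Complex.I_im,
      Complex.one_re, Complex.one_im, Complex.neg_re, Complex.neg_im]
    field_simp
    ring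

/-- **Reduction of Conrey–Li's quantity to `ζ`-data.** At a zero `ρ = ½ + iγ` (`γ > 0`) of `ζ`:
`Re{conj ξ'(ρ) · ξ(1+ρ)} = c · Re{conj ζ'(ρ) · ζ(3/2+iγ) · ((γ²−¾) − 2γi) · (1 + i·tanh(πγ/2))}`
for some `c > 0` (namely `c = (γ²+¼)√2 cosh(πγ/2) / (8 |cos(πρ/2)|²)`): `ξ'(ρ) = A(ρ)ζ'(ρ)`,
`ξ(1+ρ) = A(1+ρ)ζ(1+ρ)`, and `conj A(ρ) A(1+ρ)` is elementary by the reflection formula.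
[folklore] -/
theorem re_conj_deriv_riemannXi_mul_eq {γ : ℝ} (hγ : 0 < γ)
    (hz : riemannZeta (1 / 2 + γ * I) = 0) :
    ∃ c : ℝ, 0 < c ∧
      (conj (deriv riemannXi (1 / 2 + γ * I)) * riemannXi (1 + (1 / 2 + γ * I))).re =
        c * (conj (deriv riemannZeta (1 / 2 + γ * I)) * riemannZeta (3 / 2 + γ * I) *
              ((((γ ^ 2 - 3 / 4 : ℝ)) : ℂ) - 2 * γ * I) * (1 + (Real.tanh (π * γ / 2) : ℂ) * I)).re := by
  set ρ : ℂ := 1 / 2 + γ * I with hρ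
  have hρpos : 0 < ρ.re := by simp [hρ]
  have hρ1 : ρ ≠ 1 := fun h ↦ by
    have := congrArg Complex.im h; simp [hρ] at this; linarith
  have h1ρre : 0 < (1 + ρ).re := by simp [hρ]; norm_num
  have h1ρ1 : 1 + ρ ≠ 1 := fun h ↦ by
    have := congrArg Complex.im h; simp [hρ] at this; linarith
  have hd : deriv riemannXi ρ = xiFactor ρ * deriv riemannZeta ρ :=
    deriv_riemannXi_eq_of_zero hρpos hρ1 hz
  have hx1 : riemannXi (1 + ρ) = xiFactor (1 + ρ) * riemannZeta (1 + ρ) :=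
    riemannXi_eq_xiFactor_mul h1ρre h1ρ1
  have h32 : (1 : ℂ) + ρ = 3 / 2 + γ * I := by rw [hρ]; ring
  obtain ⟨c₁, hc₁, hinv⟩ := inv_cos_pi_mul_half_add γ
  have hfac := conj_xiFactor_mul_xiFactor γ
  rw [hinv] at hfac
  refine ⟨(γ ^ 2 + 1 / 4) / 4 * c₁, by positivity, ?_⟩
  have hmain : conj (deriv riemannXi ρ) * riemannXi (1 + ρ) =
      (((γ ^ 2 + 1 / 4) / 4 * c₁ : ℝ) : ℂ) *
        (conj (deriv riemannZeta ρ) * riemannZeta (3 / 2 + γ * I) *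
          ((((γ ^ 2 - 3 / 4 : ℝ)) : ℂ) - 2 * γ * I) * (1 + (Real.tanh (π * γ / 2) : ℂ) * I)) := by
    rw [hd, hx1, map_mul, h32]
    calc conj (xiFactor ρ) * conj (deriv riemannZeta ρ) *
          (xiFactor (3 / 2 + γ * I) * riemannZeta (3 / 2 + γ * I))
        = (conj (xiFactor ρ) * xiFactor (1 + ρ)) *
            (conj (deriv riemannZeta ρ) * riemannZeta (3 / 2 + γ * I)) := by rw [h32]; ring
      _ = _ := by
        rw [hρ, hfac]
        push_cast
        ring
  rw [hmain, Complex.re_ofReal_mul]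

/-! ## 2. The certificate -/

namespace ConreyLi2000Cert

/-- Scale `2^80` of the interval arithmetic. [folklore] -/
def S : ℕ := 2 ^ 80

/-- Tables: `N = 64`, `ν = 14`; `π` and `log n` at scale `2^90` (`95` series terms, Machin with
`22` terms), `16` Taylor terms and `8` halvings for `exp`/`expI`. [folklore] -/
def tables : Option Tables := mkTablesK S 64 14 10 95 22 16 8 16 8

/-- `t₁ = T1 / 2^48 = 111.029535543053…` (`γ₃₄ − 2⁻³³`, rounded to `2⁻⁴⁸`). [folklore] -/
def T1 : ℤ := 31252035931175869

/-- `t₂ = T2 / 2^48 = t₁ + 2⁻³²`. [folklore] -/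
def T2 : ℤ := T1 + 2 ^ 16

/-- `[t₁, t₁]`. [folklore] -/
def t1I : MI := MI.ofFrac S T1 (2 ^ 48)

/-- `[t₂, t₂]`. [folklore] -/
def t2I : MI := MI.ofFrac S T2 (2 ^ 48)

/-- `[t₁, t₂] ∋ γ`. [folklore] -/
def gammaI : MI := t1I.span t2I

/-- The box `{½ + i t₁}`. [folklore] -/
def box1 : MC := ⟨MI.ofFrac S 1 2, t1I⟩

/-- The box `{½ + i t₂}`. [folklore] -/
def box2 : MC := ⟨MI.ofFrac S 1 2, t2I⟩

/-- The box `{3/2} × [t₁, t₂]`. [folklore] -/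
def box3 : MC := ⟨MI.ofFrac S 3 2, gammaI⟩

/-- Scaled radius for the slope: `(t₂ − t₁) · 4 (t₂ + 4)³ · S ≤ 4 · 116³ · 2⁴⁸` (`t₂ + 4 ≤ 116`,
`t₂ − t₁ = 2⁻³²`). [folklore] -/
def slopeRadius : ℤ := 4 * 116 ^ 3 * 2 ^ 48

/-- The box `D ∋ ζ'(½ + iγ)` for every `γ ∈ [t₁, t₂]`: the slope `(ζ₂ − ζ₁)/((t₂ − t₁) i)
= (ζ₂ − ζ₁) · (−i) · 2³²` widened by `slopeRadius`. [folklore] -/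
def slopeBox (Z1 Z2 : MC) : MC := (((Z2.sub Z1).mulNegI).mulInt (2 ^ 32)).widen slopeRadius

/-- The box `G ∋ (γ² − ¾) − 2γ i`, `γ ∈ [t₁, t₂]`. [folklore] -/
def gBox : MC := ⟨(gammaI.sqr S).sub (MI.ofFrac S 3 4), (gammaI.mulInt 2).neg⟩

/-- The box `{1} × [15/16, 1] ∋ 1 + τ i`. [folklore] -/
def tauBox : MC := ⟨MI.ofInt S 1, (MI.ofFrac S 15 16).span (MI.ofInt S 1)⟩

/-- The final box `W ∋ conj ζ'(ρ) · ζ(3/2 + iγ) · ((γ² − ¾) − 2γ i) · (1 + τ i)`. [folklore] -/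
def wBox (Z1 Z2 Z3 : MC) : MC :=
  MC.mul S (MC.mul S (MC.mul S (slopeBox Z1 Z2).conj Z3) gBox) tauBox

/-- **The certificate check**: the three evaluations succeed, the twisted sign test
`hi Re(ζ₁ · conj ζ₂) < 0` holds, and `hi Re W < 0`. [folklore] -/
def check : Bool :=
  match tables with
  | none => false
  | some T =>
    match zetaBoxK T box1, zetaBoxK T box2, zetaBoxK T box3 with
    | some Z1, some Z2, some Z3 =>
        decide ((MC.mul S Z1 Z2.conj).re.hi < 0) && decide ((wBox Z1 Z2 Z3).re.hi < 0)
    | _, _, _ => false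

/-! ## 3. Soundness of the certificate -/

/-- `t₁ = T1 / 2⁴⁸`. [folklore] -/
noncomputable def t₁ : ℝ := (T1 : ℝ) / 2 ^ 48

/-- `t₂ = T2 / 2⁴⁸`. [folklore] -/
noncomputable def t₂ : ℝ := (T2 : ℝ) / 2 ^ 48

/-- `t₂ − t₁ = 2⁻³²`. [folklore] -/
lemma t₂_sub_t₁ : t₂ - t₁ = ((2 : ℝ) ^ 32)⁻¹ := by
  unfold t₁ t₂ T2
  push_cast
  ring

/-- `111 < t₁`. [folklore] -/
lemma lt_t₁ : (111 : ℝ) < t₁ := by unfold t₁ T1; norm_num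

/-- `t₂ < 111.5`. [folklore] -/
lemma t₂_lt : t₂ < (111.5 : ℝ) := by unfold t₂ T2 T1; norm_num

/-- `t₁ < t₂`. [folklore] -/
lemma t₁_lt_t₂ : t₁ < t₂ := by
  have h := t₂_sub_t₁
  have : (0 : ℝ) < ((2 : ℝ) ^ 32)⁻¹ := by positivity
  linarith

/-- `0 < S`. [folklore] -/
lemma S_pos : 0 < S := by unfold S; positivity

/-- `t₁ ∈ t1I`. [folklore] -/
lemma mem_t1I : MI.mem S t₁ t1I := by
  have := MI.mem_ofFrac S T1 (q := 2 ^ 48) (by positivity)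
  unfold t₁ t1I
  convert this using 2
  push_cast
  ring

/-- `t₂ ∈ t2I`. [folklore] -/
lemma mem_t2I : MI.mem S t₂ t2I := by
  have := MI.mem_ofFrac S T2 (q := 2 ^ 48) (by positivity)
  unfold t₂ t2I
  convert this using 2
  push_cast
  ring

/-- `γ ∈ gammaI` for `t₁ ≤ γ ≤ t₂`. [folklore] -/
lemma mem_gammaI {γ : ℝ} (h1 : t₁ ≤ γ) (h2 : γ ≤ t₂) : MI.mem S γ gammaI :=
  MI.mem_span mem_t1I mem_t2I h1 h2

/-- `½ + it ∈ ⟨[½], J⟩` from `t ∈ J`. [folklore] -/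
lemma mem_halfBox {t : ℝ} {J : MI} (ht : MI.mem S t J) :
    MC.mem S (1 / 2 + t * I) ⟨MI.ofFrac S 1 2, J⟩ := by
  refine ⟨?_, by simpa using ht⟩
  have := MI.mem_ofFrac S 1 (q := 2) two_pos
  simp only [Complex.add_re, Complex.div_ofNat_re, Complex.one_re, Complex.mul_re, Complex.ofReal_re,
    Complex.I_re, Complex.ofReal_im, Complex.I_im, mul_zero, zero_mul, sub_zero, add_zero]
  simpa using this

/-- `3/2 + it ∈ box3` from `t ∈ gammaI`. [folklore] -/
lemma mem_box3 {t : ℝ} (ht : MI.mem S t gammaI) : MC.mem S (3 / 2 + t * I) box3 := by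
  refine ⟨?_, by simpa [box3] using ht⟩
  have := MI.mem_ofFrac S 3 (q := 2) two_pos
  simp only [box3]
  norm_num at this ⊢
  exact this

/-- The slope as a product: `a / (2⁻³² i) = a · (−i) · 2³²`. [folklore] -/
lemma div_eq_mul_negI (a : ℂ) :
    a / (((((2 : ℝ) ^ 32)⁻¹ : ℝ) : ℂ) * I) = a * -I * ((2 ^ 32 : ℤ) : ℂ) := by
  have hI : (I : ℂ) ≠ 0 := I_ne_zero
  push_cast
  field_simp
  ring_nf
  simp [I_sq]

/-- `(γ² − ¾) − 2γ i ∈ gBox` for `γ ∈ [t₁, t₂]`. [folklore] -/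
lemma mem_gBox {γ : ℝ} (hγ : MI.mem S γ gammaI) :
    MC.mem S ((((γ ^ 2 - 3 / 4 : ℝ)) : ℂ) - 2 * γ * I) gBox := by
  refine ⟨?_, ?_⟩
  · have := MI.mem_sub (MI.mem_sqr S_pos hγ) (MI.mem_ofFrac S 3 (q := 4) (by norm_num))
    simp only [gBox, Complex.sub_re, Complex.ofReal_re, Complex.mul_re, Complex.mul_im,
      Complex.re_ofNat, Complex.im_ofNat, Complex.ofReal_im, Complex.I_re, Complex.I_im]
    convert this using 1
    push_cast
    ring
  · have := MI.mem_neg (MI.mem_mulInt hγ 2)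
    simp only [gBox, Complex.sub_im, Complex.ofReal_re, Complex.mul_im, Complex.re_ofNat,
      Complex.im_ofNat, Complex.ofReal_im, Complex.I_re, Complex.I_im, Complex.mul_re]
    convert this using 1
    push_cast
    ring

/-- `1 + τ i ∈ tauBox` for `τ ∈ [15/16, 1]`. [folklore] -/
lemma mem_tauBox {τ : ℝ} (hτ : τ ∈ Set.Icc (15 / 16 : ℝ) 1) : MC.mem S (1 + (τ : ℂ) * I) tauBox := by
  refine ⟨by simpa [tauBox] using MI.mem_ofInt S 1, ?_⟩
  have h := MI.mem_span (x := τ) (MI.mem_ofFrac S 15 (q := 16) (by norm_num)) (MI.mem_ofInt S 1)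
    (by norm_num; exact hτ.1) (by norm_num; exact hτ.2)
  simpa [tauBox] using h

/-- **Soundness of the certificate.** If `check = true` then `ζ` has a zero `½ + iγ` with
`γ ∈ [t₁, t₂]`, and for every such zero and every `τ ∈ [15/16, 1]`,
`Re{conj ζ'(½+iγ) · ζ(3/2+iγ) · ((γ²−¾) − 2γi) · (1 + τ i)} < 0`. [folklore] -/
theorem sound (h : check = true) :
    ∃ γ ∈ Set.Icc t₁ t₂, riemannZeta (1 / 2 + γ * I) = 0 ∧
      ∀ τ ∈ Set.Icc (15 / 16 : ℝ) 1,
        (conj (deriv riemannZeta (1 / 2 + γ * I)) * riemannZeta (3 / 2 + γ * I) *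
          ((((γ ^ 2 - 3 / 4 : ℝ)) : ℂ) - 2 * γ * I) * (1 + (τ : ℂ) * I)).re < 0 := by
  unfold check at h
  split at h
  · exact absurd h Bool.false_ne_true
  · rename_i T hT
    split at h
    · rename_i Z1 Z2 Z3 hZ1 hZ2 hZ3
      simp only [Bool.and_eq_true, decide_eq_true_eq] at h
      obtain ⟨hprod, hW⟩ := h
      have hV : T.Valid := mkTablesK_valid hT
      have hTS : T.S = S := mkTablesK_S hT
      have hne1 : ∀ t : ℝ, t₁ ≤ t → (1 / 2 : ℂ) + t * I ≠ 1 := fun t ht h ↦ by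
        have := congrArg Complex.im h; simp at this; linarith [lt_t₁]
      -- the two values on the line
      have hz1 : MC.mem S (riemannZeta (1 / 2 + t₁ * I)) Z1 := by
        have hb : MC.mem T.S (1 / 2 + t₁ * I) box1 := by rw [hTS]; exact mem_halfBox mem_t1I
        have := mem_zetaBoxK hV hb (hne1 t₁ le_rfl) hZ1
        rwa [hTS] at this
      have hz2 : MC.mem S (riemannZeta (1 / 2 + t₂ * I)) Z2 := by
        have hb : MC.mem T.S (1 / 2 + t₂ * I) box2 := by rw [hTS]; exact mem_halfBox mem_t2I
        have := mem_zetaBoxK hV hb (hne1 t₂ t₁_lt_t₂.le) hZ2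
        rwa [hTS] at this
      -- twisted sign test: a zero on the line in `[t₁, t₂]`
      have hneg : (riemannZeta (1 / 2 + t₁ * I) * conj (riemannZeta (1 / 2 + t₂ * I))).re < 0 :=
        MI.neg_of_hi_neg (MC.mem_mul S_pos hz1 (MC.mem_conj hz2)).1 hprod
      obtain ⟨γ, hγ, hzero⟩ := exists_zero_Icc_of_re_mul_conj_neg' (by linarith [lt_t₁])
        t₁_lt_t₂.le (by linarith [t₂_lt]) (by rw [t₂_sub_t₁]; norm_num) hneg
      refine ⟨γ, hγ, hzero, fun τ hτ ↦ ?_⟩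
      -- `ζ'(½ + iγ) ∈ slopeBox`
      have hD : MC.mem S (deriv riemannZeta (1 / 2 + γ * I)) (slopeBox Z1 Z2) := by
        have hslope := norm_deriv_riemannZeta_sub_slope_le (by linarith [lt_t₁]) t₁_lt_t₂ hγ
        have hmem : MC.mem S ((riemannZeta (1 / 2 + t₂ * I) - riemannZeta (1 / 2 + t₁ * I)) /
            ((t₂ - t₁ : ℝ) * I)) (((Z2.sub Z1).mulNegI).mulInt (2 ^ 32)) := by
          have := MC.mem_mulInt (MC.mem_mulNegI (MC.mem_sub hz2 hz1)) (2 ^ 32)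
          rwa [t₂_sub_t₁, div_eq_mul_negI]
        unfold slopeBox
        apply MC.mem_widen hmem
        calc ‖deriv riemannZeta (1 / 2 + γ * I) -
                (riemannZeta (1 / 2 + t₂ * I) - riemannZeta (1 / 2 + t₁ * I)) / ((t₂ - t₁ : ℝ) * I)‖ * S
            ≤ (t₂ - t₁) * (4 * (t₂ + 4) ^ 3) * S :=
              mul_le_mul_of_nonneg_right hslope (by positivity)
          _ ≤ slopeRadius := by
              rw [t₂_sub_t₁]
              have ht : t₂ + 4 ≤ 116 := by linarith [t₂_lt]
              have ht0 : 0 < t₂ := by linarith [lt_t₁, t₁_lt_t₂]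
              have h3 : (t₂ + 4) ^ 3 ≤ 116 ^ 3 := by gcongr
              have e : ((2 : ℝ) ^ 32)⁻¹ * (4 * (t₂ + 4) ^ 3) * (S : ℝ) = 4 * (t₂ + 4) ^ 3 * 2 ^ 48 := by
                unfold S
                push_cast
                field_simp
                ring
              rw [e]
              unfold slopeRadius
              push_cast
              nlinarith
      -- `ζ(3/2 + iγ) ∈ Z3`
      have hγI : MI.mem S γ gammaI := mem_gammaI hγ.1 hγ.2
      have hz3 : MC.mem S (riemannZeta (3 / 2 + γ * I)) Z3 := by
        have hb : MC.mem T.S (3 / 2 + γ * I) box3 := by rw [hTS]; exact mem_box3 hγI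
        have hne : (3 / 2 : ℂ) + γ * I ≠ 1 := fun h ↦ by
          have := congrArg Complex.im h; simp at this; linarith [lt_t₁, hγ.1]
        have := mem_zetaBoxK hV hb hne hZ3
        rwa [hTS] at this
      -- the final product
      have hWmem := MC.mem_mul S_pos (MC.mem_mul S_pos (MC.mem_mul S_pos (MC.mem_conj hD) hz3)
        (mem_gBox hγI)) (mem_tauBox hτ)
      exact MI.neg_of_hi_neg hWmem.1 hW
    · exact absurd h Bool.false_ne_true

end ConreyLi2000Cert

/-- **Discharge of `ConreyLi2000_HE`** (Conrey–Li 2000, §3.1 (3.2)): at the 34th zero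
`ρ = ½ + iγ₃₄`, `γ₃₄ = 111.0295355…`, of `ζ` one has `Re{conj ξ'(ρ) · ξ(1+ρ)} < 0`. Proof: the
kernel-checked certificate `ConreyLi2000Cert.check_holds` brackets a zero `γ ∈ [t₁, t₂]`
(`t₂ − t₁ = 2⁻³²`, inside `(111, 111.5)`) by the twisted sign test and bounds
`Re{conj ζ'(ρ) ζ(1+ρ) ((γ²−¾) − 2γi)(1 + τ i)} < 0` for `τ ∈ [15/16, 1]`; the reduction
`re_conj_deriv_riemannXi_mul_eq` (reflection formula for `Γ_ℝ`, no `Γ`-numerics) turns this into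
the sign of Conrey–Li's quantity (their printed value, for `ξ_CL = 2ξ`, is `−5.389…·10⁻⁶⁹`).
[cite: ConreyLi2000, §3.1 (3.2)] -/
theorem ConreyLi2000_HE_holds_of_check (hc : ConreyLi2000Cert.check = true) : ConreyLi2000_HE := by
  obtain ⟨γ, ⟨hγ1, hγ2⟩, hz, hneg⟩ := ConreyLi2000Cert.sound hc
  have h111 : (111 : ℝ) < γ := lt_of_lt_of_le ConreyLi2000Cert.lt_t₁ hγ1
  have h1115 : γ < 111.5 := lt_of_le_of_lt hγ2 ConreyLi2000Cert.t₂_lt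
  have h3 : (3 : ℝ) ≤ γ := by linarith
  refine ⟨1 / 2 + γ * I, ?_, by simp, by simpa using h111, by simpa using h1115, ?_⟩
  · have hne : (1 / 2 : ℂ) + γ * I ≠ 1 := fun h ↦ by
      have := congrArg Complex.im h; simp at this; linarith
    rw [riemannXi_eq_xiFactor_mul (by simp) hne, hz, mul_zero]
  · obtain ⟨c, hc, heq⟩ := re_conj_deriv_riemannXi_mul_eq (by linarith) hz
    rw [heq]
    exact mul_neg_of_pos_of_neg hc (hneg _ (tanh_mem_Icc h3))

/-! ## 4. The kernel's verdict and the discharge -/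

/-- **The kernel accepts the certificate** (`decide +kernel`, about `30 s`: tables, three
evaluations of `ζ` at scale `2^80`, and the two sign checks). [folklore] -/
theorem ConreyLi2000Cert.check_holds : ConreyLi2000Cert.check = true := by
  decide +kernel

/-- **`ConreyLi2000_HE` holds**: de Branges' `𝓗(E)`-positivity condition (3.1) fails for `ζ`,
witnessed at the 34th zero (Conrey–Li 2000, §3.1 (3.2)), with the sign of
`Re{conj ξ′(ρ) ξ(1+ρ)}` now certified by the Lean kernel. [cite: ConreyLi2000, §3.1 (3.2)] -/
theorem ConreyLi2000_HE_holds : ConreyLi2000_HE :=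
  ConreyLi2000_HE_holds_of_check ConreyLi2000Cert.check_holds

/-- **The barrier `DeBrangesPositivity` holds unconditionally**: both of de Branges' positivity
conditions fail for `ζ` — (3.1) for `𝓗(ξ(1 − iz))` by `ConreyLi2000_HE_holds` (this file) and (3.3)
for `𝓕(1/ξ(1 − iz))` by `ConreyLi2000_FW_holds` (Sarnak's proof, `DeBrangesPositivityProofs.lean`).
[cite: ConreyLi2000, §3.1 and §4] -/
theorem DeBrangesPositivity_holds : DeBrangesPositivity :=
  ⟨ConreyLi2000_HE_holds, ConreyLi2000_FW_holds⟩

end Literature.Barriers.RiemannHypothesis
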